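import Literature.Geometry.Symplectic.JHolomorphicFlatUniqueContinuation
import Literature.Geometry.Symplectic.DbarInequalityZeroDichotomy
import Mathlib.Analysis.Calculus.FDeriv.Mul
import Mathlib.Analysis.Calculus.ContDiff.Operations
import Mathlib.Analysis.InnerProductSpace.PiL2
import Mathlib.Analysis.Convex.PathConnected

/-!
# Flat unique continuation for `J`-curves in `ℝ⁴` from the `∂̄`-inequality zero dichotomy

Crux `WitnessCharge` (stmt-SmoothPoincare4-7824), line `Sketch`.
`Literature.Geometry.Symplectic.jHolomorphicFlat_uniqueContinuation_const` (unique continuation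
from an open set for flat `Jc`-holomorphic discs in `ℝ⁴`, McDuff 1991 Lemma 2.3 in coordinates) is
PROVED from the single analytic atom `Literature.Geometry.Symplectic.dbarInequality_zeroDichotomy`
(zeros of a solution of `|∂̄v| ≤ K|v|` are isolated or fill a neighbourhood; Carleman–Bers–Vekua
similarity principle, Wendl Thm 2.50): `jHolomorphicFlat_uniqueContinuation_const_of_zeroDichotomy`.

Proof. Let `S` be the locus of points of the disc near which `u = u z₀`; it is open, contains `z₀`,
and the disc is connected, so it suffices that `S` be relatively closed. At `z₁ ∈ closure S` in
the disc put `j z := Jc (u z)` (`C^∞` on the disc, `j z ∘ j z = -1`) and `w := u - u z₀`, so that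
`∂ₜw = j ∂ₛw` (`∂ₛ = D(·)(1)`, `∂ₜ = D(·)(i)`). TRIVIALISATION WITHOUT COORDINATES: with the
componentwise real embedding `ι : ℝ⁴ → ℂ⁴` put `v z := ι (w z) - i • ι (j z (w z)) ∈ ℂ⁴`; the
real-linear map `M z := ι - i • ι ∘ j z` intertwines `j z` with multiplication by `i`
(`M ∘ j = i • M`, using `j² = -1`), and `Re ∘ M = id`, so `w = Re ∘ v` and `‖w‖ ≤ C‖v‖`. The product
rule gives `∂ₛv + i ∂ₜv = ι ((∂ₜj) w) - i • ι ((∂ₛj) w)`, whence `‖∂ₛv + i∂ₜv‖ ≤ K ‖v‖` on a closed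
sub-disc around `z₁` (bounded `Dj` by compactness). Near a point `z₂ ∈ S` close to `z₁`, `v = 0`;
the locus `Z` where `v` vanishes locally is open, and relatively closed in the sub-disc by the
atom (at a point `z₃` of its closure, `v z₃ = 0` by continuity, and an isolated zero at `z₃` is
impossible since `Z ∌ z₃` accumulates at `z₃`), hence all of the (connected) sub-disc; so `v = 0`,
i.e. `u = u z₀`, near `z₁`.
-/

noncomputable section

set_option linter.dupNamespace false

open scoped ContDiff Topology
open Set Filter Metric

namespace Summit.SmoothPoincare4.SmoothPoincare4.Theorems.WitnessCharge.PencilIncompleteness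

open Literature.Geometry.Symplectic

/-- The componentwise real embedding `ι : ℝ⁴ → ℂ⁴` and the componentwise real part `R : ℂ⁴ → ℝ⁴`
(as real continuous linear maps): `R ∘ ι = id` and `R (i • ι x) = 0`. -/
private theorem exists_realEmbedding :
    ∃ (ι : EuclideanSpace ℝ (Fin 4) →L[ℝ] (Fin 4 → ℂ))
      (R : (Fin 4 → ℂ) →L[ℝ] EuclideanSpace ℝ (Fin 4)),
      (∀ x, R (ι x) = x) ∧ ∀ x, R (Complex.I • ι x) = 0 := by
  refine ⟨(ContinuousLinearMap.pi fun k => Complex.ofRealCLM.comp (ContinuousLinearMap.proj k)).comp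
      (EuclideanSpace.equiv (Fin 4) ℝ : EuclideanSpace ℝ (Fin 4) →L[ℝ] (Fin 4 → ℝ)),
    (↑(EuclideanSpace.equiv (Fin 4) ℝ).symm : (Fin 4 → ℝ) →L[ℝ] EuclideanSpace ℝ (Fin 4)).comp
      (ContinuousLinearMap.pi fun k => Complex.reCLM.comp (ContinuousLinearMap.proj k)), ?_, ?_⟩
  · intro x
    simp
  · intro x
    ext k
    simp

/-- The `∂̄` of the trivialised difference: if `Dw(i) = j (Dw(1))` and `j ∘ j = -1` at `z`, then for
`v := ι ∘ w - i • ι ∘ (j w)` one has `Dv(1) + i • Dv(i) = ι ((Dj(i)) w) - i • ι ((Dj(1)) w)` at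
`z` (product rule; the first-order terms cancel). -/
private theorem dbar_trivialised {F : Type*} [NormedAddCommGroup F] [NormedSpace ℂ F]
    (ι : EuclideanSpace ℝ (Fin 4) →L[ℝ] F)
    {j : ℂ → EuclideanSpace ℝ (Fin 4) →L[ℝ] EuclideanSpace ℝ (Fin 4)}
    {w : ℂ → EuclideanSpace ℝ (Fin 4)}
    {j' : ℂ →L[ℝ] EuclideanSpace ℝ (Fin 4) →L[ℝ] EuclideanSpace ℝ (Fin 4)}
    {w' : ℂ →L[ℝ] EuclideanSpace ℝ (Fin 4)} {z : ℂ}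
    (hj : HasFDerivAt j j' z) (hw : HasFDerivAt w w' z)
    (hsq : ∀ x, j z (j z x) = -x) (hhol : w' Complex.I = j z (w' 1)) :
    fderiv ℝ (fun y => ι (w y) - Complex.I • ι (j y (w y))) z 1
        + Complex.I • fderiv ℝ (fun y => ι (w y) - Complex.I • ι (j y (w y))) z Complex.I
      = ι (j' Complex.I (w z)) - Complex.I • ι (j' 1 (w z)) := by
  have hv : HasFDerivAt (fun y => ι (w y) - Complex.I • ι (j y (w y)))
      (ι.comp w' - Complex.I • ι.comp ((j z).comp w' + j'.flip (w z))) z :=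
    (ι.hasFDerivAt.comp z hw).sub ((ι.hasFDerivAt.comp z (hj.clm_apply hw)).const_smul Complex.I)
  rw [hv.fderiv]
  simp only [sub_apply, smul_apply, ContinuousLinearMap.comp_apply, add_apply,
    ContinuousLinearMap.flip_apply, hhol, hsq, map_add, map_neg, smul_add, smul_sub, smul_neg,
    smul_smul, Complex.I_mul_I, neg_smul, one_smul]
  abel

/-- Smoothness of the trivialised difference `v := ι ∘ w - i • ι ∘ (j w)`. -/
private theorem contDiffOn_trivialised {F : Type*} [NormedAddCommGroup F] [NormedSpace ℂ F]
    (ι : EuclideanSpace ℝ (Fin 4) →L[ℝ] F) {n : WithTop ℕ∞} {s : Set ℂ}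
    {j : ℂ → EuclideanSpace ℝ (Fin 4) →L[ℝ] EuclideanSpace ℝ (Fin 4)}
    {w : ℂ → EuclideanSpace ℝ (Fin 4)} (hj : ContDiffOn ℝ n j s) (hw : ContDiffOn ℝ n w s) :
    ContDiffOn ℝ n (fun y => ι (w y) - Complex.I • ι (j y (w y))) s :=
  (ι.contDiff.comp_contDiffOn hw).sub
    ((ι.contDiff.comp_contDiffOn (hj.clm_apply hw)).const_smul Complex.I)

/-- **Zero propagation from the atom.** If `v` is `C¹` on `ball z₁ δ` with
`‖Dv(1) + i • Dv(i)‖ ≤ K‖v‖` there, and `v` vanishes near some point of the disc, then (GIVEN the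
zero dichotomy `dbarInequality_zeroDichotomy`) `v` vanishes near every point of the disc: the
locus where `v` vanishes locally is open, non-empty, and relatively closed (an accumulation point
`z₃` of it in the disc has `v z₃ = 0` by continuity and cannot be an isolated zero). -/
private theorem eventually_zero_of_zeroDichotomy (hatom : dbarInequality_zeroDichotomy)
    {F : Type} [NormedAddCommGroup F] [NormedSpace ℂ F] [FiniteDimensional ℂ F]
    {v : ℂ → F} {z₁ : ℂ} {δ K : ℝ} (hv : ContDiffOn ℝ 1 v (ball z₁ δ))
    (hK : ∀ z ∈ ball z₁ δ, ‖fderiv ℝ v z 1 + Complex.I • fderiv ℝ v z Complex.I‖ ≤ K * ‖v z‖)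
    {z₂ : ℂ} (hz₂ : z₂ ∈ ball z₁ δ) (hvz₂ : ∀ᶠ z in 𝓝 z₂, v z = 0) :
    ∀ z ∈ ball z₁ δ, ∀ᶠ y in 𝓝 z, v y = 0 := by
  set Z : Set ℂ := {z | ∀ᶠ y in 𝓝 z, v y = 0}
  have hZopen : IsOpen Z := isOpen_iff_mem_nhds.2 fun z hz => hz.eventually_nhds
  have hZcl : closure Z ∩ ball z₁ δ ⊆ Z := by
    rintro z₃ ⟨hz₃Z, hz₃⟩
    by_contra hz₃Z'
    have hfr : ∃ᶠ z in 𝓝 z₃, z ∈ Z := mem_closure_iff_frequently.1 hz₃Z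
    have hvz₃ : v z₃ = 0 := by
      have hcont : ContinuousAt v z₃ := hv.continuousOn.continuousAt (isOpen_ball.mem_nhds hz₃)
      have h0 := mem_closure_of_frequently_of_tendsto
        (hfr.mono fun z hz => (show v z ∈ ({0} : Set F) from hz.self_of_nhds)) hcont
      rwa [closure_singleton, mem_singleton_iff] at h0
    obtain ⟨ρ, hρ, hρsub⟩ : ∃ ρ > 0, ball z₃ ρ ⊆ ball z₁ δ := Metric.isOpen_iff.1 isOpen_ball z₃ hz₃
    rcases hatom F z₃ ρ K hρ v (hv.mono hρsub) (fun z hz => hK z (hρsub hz)) hvz₃ with h | h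
    · exact hz₃Z' h
    · rw [eventually_nhdsWithin_iff] at h
      obtain ⟨z, hzZ, hz'⟩ := (hfr.and_eventually h).exists
      by_cases hzz : z = z₃
      · exact hz₃Z' (hzz ▸ hzZ)
      · exact hz' hzz hzZ.self_of_nhds
  have hsub : ball z₁ δ ⊆ Z :=
    (convex_ball z₁ δ).isPreconnected.subset_of_closure_inter_subset hZopen ⟨z₂, hz₂, hvz₂⟩ hZcl
  exact fun z hz => hsub hz

/-- **Flat unique continuation from the zero dichotomy (registered stub).** GIVEN the zero
dichotomy for the `∂̄`-inequality (`dbarInequality_zeroDichotomy`, the similarity principle), a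
flat `Jc`-holomorphic `C^∞` disc in an open set of `ℝ⁴` which is constant near one point is
constant: the locus `S` where `u = u z₀` locally is open and non-empty in the connected disc, and
relatively closed because near `z₁ ∈ closure S` the trivialised difference
`v := ι (u - u z₀) - i • ι (Jc(u) (u - u z₀)) ∈ ℂ⁴` (`ι : ℝ⁴ → ℂ⁴` the real embedding) satisfies
`‖∂ₛv + i∂ₜv‖ ≤ K‖v‖`, vanishes near a point of `S`, hence near `z₁` by
`eventually_zero_of_zeroDichotomy`, and `u - u z₀ = Re v`. -/
theorem jHolomorphicFlat_uniqueContinuation_const_of_zeroDichotomy :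
    Literature.Geometry.Symplectic.dbarInequality_zeroDichotomy →
    Literature.Geometry.Symplectic.jHolomorphicFlat_uniqueContinuation_const := by
  intro hatom T _hT Jc hJcs hJc2 c r _hr u hus huT huJ z₀ hz₀ hloc
  set S : Set ℂ := {z | ∀ᶠ w in 𝓝 z, u w = u z₀}
  have hSopen : IsOpen S := isOpen_iff_mem_nhds.2 fun z hz => hz.eventually_nhds
  -- the embedding `ℝ⁴ → ℂ⁴` and the real part
  obtain ⟨ι, R, hRι, hRI⟩ := exists_realEmbedding
  -- the field of complex structures along the curve and the trivialised difference
  set j : ℂ → EuclideanSpace ℝ (Fin 4) →L[ℝ] EuclideanSpace ℝ (Fin 4) := fun z => Jc (u z)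
  have hjs : ContDiffOn ℝ ∞ j (ball c r) := hJcs.comp hus huT
  set v : ℂ → (Fin 4 → ℂ) := fun z => ι (u z - u z₀) - Complex.I • ι (j z (u z - u z₀)) with hvdef
  have hRv : ∀ z, R (v z) = u z - u z₀ := fun z => by
    show R (ι (u z - u z₀) - Complex.I • ι (j z (u z - u z₀))) = u z - u z₀
    rw [map_sub, hRι, hRI, sub_zero]
  have hws : ContDiffOn ℝ ∞ (fun z => u z - u z₀) (ball c r) := hus.sub contDiffOn_const
  have hvs : ContDiffOn ℝ 1 v (ball c r) :=
    (contDiffOn_trivialised ι hjs hws).of_le (by exact_mod_cast le_top)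
  -- the `∂̄` of `v`, pointwise on the disc
  have hdbar : ∀ z ∈ ball c r, fderiv ℝ v z 1 + Complex.I • fderiv ℝ v z Complex.I
      = ι (fderiv ℝ j z Complex.I (u z - u z₀)) - Complex.I • ι (fderiv ℝ j z 1 (u z - u z₀)) := by
    intro z hz
    have hzn : ball c r ∈ 𝓝 z := isOpen_ball.mem_nhds hz
    have hj : HasFDerivAt j (fderiv ℝ j z) z :=
      ((hjs.differentiableOn (by simp)).differentiableAt hzn).hasFDerivAt
    have hw : HasFDerivAt (fun y => u y - u z₀) (fderiv ℝ u z) z :=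
      ((hus.differentiableOn (by simp)).differentiableAt hzn).hasFDerivAt.sub_const _
    have hhol : fderiv ℝ u z Complex.I = j z (fderiv ℝ u z 1) := by
      have h := huJ z hz 1
      rwa [mul_one] at h
    exact dbar_trivialised ι hj hw (fun x => hJc2 (u z) (huT hz) x) hhol
  -- relative closedness of `S` in the disc
  have hkey : closure S ∩ ball c r ⊆ S := by
    rintro z₁ ⟨hz₁S, hz₁⟩
    -- a closed disc around `z₁` inside the disc, and a bound for `Dj` on it
    obtain ⟨δ, hδ, hδsub⟩ : ∃ δ, 0 < δ ∧ closedBall z₁ δ ⊆ ball c r :=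
      nhds_basis_closedBall.mem_iff.1 (isOpen_ball.mem_nhds hz₁)
    have hbsub : ball z₁ δ ⊆ ball c r := ball_subset_closedBall.trans hδsub
    obtain ⟨B, hB⟩ : ∃ B, ∀ z ∈ closedBall z₁ δ, ‖fderiv ℝ j z‖ ≤ B :=
      (isCompact_closedBall z₁ δ).exists_bound_of_continuousOn
        ((hjs.continuousOn_fderiv_of_isOpen isOpen_ball (by exact_mod_cast le_top)).mono hδsub)
    have hB0 : 0 ≤ B := (norm_nonneg (fderiv ℝ j z₁)).trans (hB z₁ (mem_closedBall_self hδ.le))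
    -- the inequality `‖∂ₛv + i ∂ₜv‖ ≤ K ‖v‖` on `ball z₁ δ`
    have hK : ∀ z ∈ ball z₁ δ, ‖fderiv ℝ v z 1 + Complex.I • fderiv ℝ v z Complex.I‖
        ≤ (2 * ‖ι‖ * B * ‖R‖) * ‖v z‖ := by
      intro z hz
      rw [hdbar z (hbsub hz)]
      have hjz : ‖fderiv ℝ j z‖ ≤ B := hB z (ball_subset_closedBall hz)
      have hwv : ‖u z - u z₀‖ ≤ ‖R‖ * ‖v z‖ := by
        rw [← hRv z]
        exact R.le_opNorm _
      have hone : ∀ ζ : ℂ, ‖ζ‖ ≤ 1 →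
          ‖ι (fderiv ℝ j z ζ (u z - u z₀))‖ ≤ ‖ι‖ * (B * (‖R‖ * ‖v z‖)) := by
        intro ζ hζ
        calc ‖ι (fderiv ℝ j z ζ (u z - u z₀))‖
            ≤ ‖ι‖ * ‖fderiv ℝ j z ζ (u z - u z₀)‖ := ι.le_opNorm _
          _ ≤ ‖ι‖ * (‖fderiv ℝ j z ζ‖ * ‖u z - u z₀‖) := by
            gcongr; exact (fderiv ℝ j z ζ).le_opNorm _
          _ ≤ ‖ι‖ * ((‖fderiv ℝ j z‖ * ‖ζ‖) * ‖u z - u z₀‖) := by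
            gcongr; exact (fderiv ℝ j z).le_opNorm ζ
          _ ≤ ‖ι‖ * ((B * 1) * (‖R‖ * ‖v z‖)) := by
            gcongr
          _ = ‖ι‖ * (B * (‖R‖ * ‖v z‖)) := by rw [mul_one]
      calc ‖ι (fderiv ℝ j z Complex.I (u z - u z₀)) - Complex.I • ι (fderiv ℝ j z 1 (u z - u z₀))‖
          ≤ ‖ι (fderiv ℝ j z Complex.I (u z - u z₀))‖
            + ‖Complex.I • ι (fderiv ℝ j z 1 (u z - u z₀))‖ := norm_sub_le _ _
        _ = ‖ι (fderiv ℝ j z Complex.I (u z - u z₀))‖ + ‖ι (fderiv ℝ j z 1 (u z - u z₀))‖ := by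
            rw [norm_smul, Complex.norm_I, one_mul]
        _ ≤ ‖ι‖ * (B * (‖R‖ * ‖v z‖)) + ‖ι‖ * (B * (‖R‖ * ‖v z‖)) :=
            add_le_add (hone Complex.I (by simp)) (hone 1 (by simp))
        _ = (2 * ‖ι‖ * B * ‖R‖) * ‖v z‖ := by ring
    -- a point of `S` in the small disc; `v` vanishes near it
    obtain ⟨z₂, hz₂S, hz₂⟩ : ∃ z₂ ∈ S, dist z₁ z₂ < δ := Metric.mem_closure_iff.1 hz₁S δ hδ
    have hz₂b : z₂ ∈ ball z₁ δ := mem_ball'.2 hz₂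
    have hvz₂ : ∀ᶠ z in 𝓝 z₂, v z = 0 := by
      filter_upwards [hz₂S] with z hz
      simp only [hvdef, hz, sub_self, map_zero, smul_zero]
    -- zero propagation over the small disc, back to `u`
    have hz₁Z := eventually_zero_of_zeroDichotomy hatom (hvs.mono hbsub) hK hz₂b hvz₂ z₁
      (mem_ball_self hδ)
    filter_upwards [hz₁Z] with z hz
    have h := hRv z
    rw [hz, map_zero] at h
    exact (sub_eq_zero.1 h.symm)
  have hsub : ball c r ⊆ S :=
    (convex_ball c r).isPreconnected.subset_of_closure_inter_subset hSopen ⟨z₀, hz₀, hloc⟩ hkey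
  intro z hz
  exact (hsub hz).self_of_nhds

end Summit.SmoothPoincare4.SmoothPoincare4.Theorems.WitnessCharge.PencilIncompleteness
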